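import Literature.AnabelianGeometry.EtaleTheta.SettingModelTateTheta
import HarnessLib

/-!
# The stage-2 model of the [EtTh] §1 root: THE TATE INSTANCE `ThetaSetting.modelTate p := modelχq p 1 2`

Mochizuki, *The étale theta function …*, Publ. RIMS **45** (2009) [EtTh], §1, PRIMS PDF pp. 11–14 and Prop. 1.5 (iii)
p. 23 [cite: MochizukiEtTh2009, §1 p.13]: the extension class of `(Δ^tp_X)^ell` is the Kummer class of the
`q`-parameter `q_X`, and the deck transformation of `Ÿ → X` acts on the theta class through
"`−2N·log(Ü) − N²·log(q̈)`" (abc-iut-L2-t12's class-two normal form `a⁻¹ g a = b^{2κ} c^{−κ} g`, `κ = κ(q̈)`).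
abc-iut cell, layer L2, R78 cluster STAGE 2, hand F5q sequel **(s1)** = seat abc-iut-L2-t5 (gen 6), L2-lead ruling
R239 «GO L2-t5 (s1) (i,j) = (1,2)»: among the `(i, j)`-generic stage-2 records `ThetaSetting.modelχq p i j hj`
(`SettingModelTateTheta`, F5q) the one realising print's law is `(i, j) = (1, 2)` — shear exponent `κ_p² = κ(q_X)`
(`q_X = p²`) and inner exponent `+κ_p = κ(q̈)` (`q̈ = p`), by abc-iut-w5-d249's kernel certificate
`SettingModelTateDeckRelation.hHat_eta_inv_mul_affTwist₃_eta` (`a⁻¹·θ_σ(a) ≡ b^{k}·c^{−m}` at every level: the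
`c`-exponent of L2-t12's normal form is MINUS the inner exponent). This file only NAMES that instance and re-exports
its root clauses; everything is a specialisation of F5q BY NAME.

* `ThetaSetting.modelTate p : ThetaSetting p := modelχq p 1 2 even_two`, with `rfl` lemmas for the carriers
  (`Π^tp_X = PiTpχq p 1 2`, `q_X = p²`, `q̈ = p`, `K = ℚ_p`, `Π^tp_{Y_N} = YNχq p 1 2 N`, `Π^tp_{Z_N} = ZNχq p 1 2 N`);
* `modelTate_isEtThOrigin`, `hYcl_modelTate`, `modelTate_isEtThOrigin_and_hYcl`, `isOpenMap_aug_modelTate`.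

HONEST LABEL: semi-synthetic model (consistency evidence only, NOT the tempered `π₁` of a curve); nothing of [EtTh] is
asserted; nothing here bears on [IUTchIII] Cor. 3.12. Class (b) MODEL file (one `abbrev`, no instance).
-/

noncomputable section

namespace Literature.AnabelianGeometry.EtaleTheta

open Literature.AnabelianGeometry.SemiGraphs SettingModel

variable (p : ℕ) [Fact p.Prime]

/-- **The Tate instance of the stage-2 root model**: `Π^tp_X := (F̂₂ ×_Ẑ ℤ) ⋊_{(κ_p, κ_p², χ)} G_{ℚ_p}`, i.e.
`θ_σ = Inn(b^{κ_p(σ)}) ∘ shear (κ_p(σ)²) ∘ θ_{χ(σ)}` (`a⁻¹·θ_σ(a) ≡ b^{2κ_p(σ)}·c^{−κ_p(σ)}`), `K = ℚ_p`, `q_X = p²`,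
`q̈ = p`. [cite: MochizukiEtTh2009, §1 p.13] -/
abbrev ThetaSetting.modelTate : ThetaSetting p := ThetaSetting.modelχq p 1 2 even_two

namespace SettingModel

/-- `Π^tp_X` of the Tate instance is `Γ ⋊_{actχq p 1 2} G_{ℚ_p}`. [cite: MochizukiEtTh2009, §1 p.12] -/
theorem piTemp_modelTate : (ThetaSetting.modelTate p).PiTemp = PiTpχq p 1 2 := rfl

/-- `K = ℚ_p`. [cite: MochizukiEtTh2009, §1 p.11] -/
theorem K_modelTate : (ThetaSetting.modelTate p).K = ⊥ := rfl

/-- `q_X = p²`. [cite: MochizukiEtTh2009, §1 p.13] -/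
theorem qX_modelTate : (ThetaSetting.modelTate p).qX = qModel p := rfl

/-- `q̈ = q_X^{1/2} = p`. [cite: MochizukiEtTh2009, §1 p.17] -/
theorem sqrtqX_modelTate : (ThetaSetting.modelTate p).sqrtqX = ((p : ℕ) : PadicAlgCl p) := rfl

/-- `Π^tp_X ↠ Z` is the degree `g ↦ pr₂(g.left)`. [cite: MochizukiEtTh2009, §1 p.12] -/
theorem toZ_modelTate_apply (g : PiTpχq p 1 2) :
    (ThetaSetting.modelTate p).toZ g = gfpSnd g.left := rfl

/-- `Π^tp_{Y_N} = Δ^tp_{Y_N} ⋊ G_{K_N}`. [cite: MochizukiEtTh2009, §1 p.13] -/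
theorem gtpYN_modelTate (N : ℕ+) : (ThetaSetting.modelTate p).GtpYN N = YNχq p 1 2 N := rfl

/-- `Π^tp_{Z_N} = Δ^tp_{Z_N} ⋊ G_{J_N}`. [cite: MochizukiEtTh2009, §1 p.14] -/
theorem gtpZN_modelTate (N : ℕ+) : (ThetaSetting.modelTate p).GtpZN N = ZNχq p 1 2 N := rfl

/-- `(Π^tp_X)^Θ` is abc-iut-L2-d1's `CurveTheta.GTheta (curveχq p 1 2)`. [cite: MochizukiEtTh2009, §1 p.12] -/
theorem gtpTheta_modelTate : (ThetaSetting.modelTate p).GtpTheta = CurveTheta.GTheta (curveχq p 1 2) := rfl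

/-- **The Tate instance satisfies the guard `IsEtThOrigin`.** [cite: MochizukiEtTh2009, §1 p.12] -/
theorem _root_.Literature.AnabelianGeometry.EtaleTheta.ThetaSetting.modelTate_isEtThOrigin :
    (ThetaSetting.modelTate p).IsEtThOrigin :=
  ThetaSetting.modelχq_isEtThOrigin p 1 2 even_two

/-- **`hYcl` holds at the Tate instance.** [cite: MochizukiEtTh2009, §1 p.12] -/
theorem hYcl_modelTate :
    ((ThetaSetting.modelTate p).DtpY.map (ThetaSetting.modelTate p).toHat.toMonoidHom).topologicalClosure ≤
      (ThetaSetting.modelTate p).DtpY.map (ThetaSetting.modelTate p).toHat.toMonoidHom ⊔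
        (⁅⁅(ThetaSetting.modelTate p).DeltaHat, (ThetaSetting.modelTate p).DeltaHat⁆,
          (ThetaSetting.modelTate p).DeltaHat⁆).topologicalClosure :=
  hYcl_modelχq p 1 2 even_two

/-- **Root + guard + `hYcl` hold together at the Tate instance.** [cite: MochizukiEtTh2009, §1 p.12] -/
theorem _root_.Literature.AnabelianGeometry.EtaleTheta.ThetaSetting.modelTate_isEtThOrigin_and_hYcl :
    (ThetaSetting.modelTate p).IsEtThOrigin ∧
      ((ThetaSetting.modelTate p).DtpY.map (ThetaSetting.modelTate p).toHat.toMonoidHom).topologicalClosure ≤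
        (ThetaSetting.modelTate p).DtpY.map (ThetaSetting.modelTate p).toHat.toMonoidHom ⊔
          (⁅⁅(ThetaSetting.modelTate p).DeltaHat, (ThetaSetting.modelTate p).DeltaHat⁆,
            (ThetaSetting.modelTate p).DeltaHat⁆).topologicalClosure :=
  ThetaSetting.modelχq_isEtThOrigin_and_hYcl p 1 2 even_two

/-- **`aug` is an open map at the Tate instance.** [cite: MochizukiEtTh2009, §1 p.12] -/
theorem isOpenMap_aug_modelTate : IsOpenMap (ThetaSetting.modelTate p).aug := isOpenMap_aug_modelχq p 1 2 even_two

end SettingModel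

end Literature.AnabelianGeometry.EtaleTheta

end
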